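import Summits.SmoothPoincare4.SmoothPoincare4.Theorems.ConvexBisectionAcyclicBisectionExistsCountsLength
import Literature.Topology.FourManifolds.LefschetzHandlebody
import HarnessLib

/-!
# Stub `stub_modelsOnFibred_balance` (NF3) at genus `0` — line `modp-braid-orbits` (r11) of crux
# `ConvexBisection.AcyclicBisectionExists` (stmt-SmoothPoincare4-10508)

The registered stub `stub_modelsOnFibred_balance` is verbatim the named Literature fact
`Literature.Topology.FourManifolds.LefschetzBase.modelsOnFibred_balance_of_homotopyEquiv_sphere`
(Etnyre–Fuller 2006, eq. (d3) p. 7): a fibred Lefschetz model `ModelsOnFibred M g l` of a homotopy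
4-sphere `M` has exactly `2g` positive letters.  The general case goes through the `d₃` invariant of
the seam contact structure (no tree vocabulary yet).  This file proves the genus-`0` instance, which
needs no contact topology: by the landed count `stub_modelsOn_counts_length` (p121211: Euler
characteristics, `l.length = 4g`) a model of a homotopy 4-sphere over the genus-`0` base has NO
letters, so it has `0 = 2 · 0` positive ones.

No definitions, no named facts, no `sorry`.
-/

noncomputable section

-- the prescribed namespace `Summit.<P>.<Sub>.…` duplicates `SmoothPoincare4` (P = Sub)
set_option linter.dupNamespace false

open scoped Manifold ContDiff Topology ContinuousMap
open Literature.Topology.FourManifolds Literature.Topology.FourManifolds.LefschetzBase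

namespace Summit.SmoothPoincare4.SmoothPoincare4.Theorems.AcyclicBisectionExists.ModpBraidOrbits

/-- **Genus-`0` case of the chirality balance `stub_modelsOnFibred_balance`** (NF3 =
`LefschetzBase.modelsOnFibred_balance_of_homotopyEquiv_sphere`, Etnyre–Fuller 2006 eq. (d3)): a fibred
Lefschetz model of a homotopy 4-sphere over the genus-`0` base `Base 0 ≅ D² × D²` has `2 · 0 = 0`
positive letters — indeed no letters at all, since `l.length = 4 · 0` by the Euler-characteristic count
`stub_modelsOn_counts_length` applied to the underlying one-sided model `hM.modelsOn`.
[cite: EtnyreFuller2006, eq. (d3) p. 7] -/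
theorem helper_modelsOnFibred_balance_genus_zero :
    ∀ (M : Type) [TopologicalSpace M] [T2Space M] [SecondCountableTopology M]
      [ChartedSpace (EuclideanSpace ℝ (Fin 4)) M] [IsManifold (𝓡 4) ∞ M]
      (l : List ((Fin 0 ⊕ Fin 0 → ℤ) × Bool)),
      M ≃ₕ Metric.sphere (0 : EuclideanSpace ℝ (Fin 5)) 1 →
      Literature.Topology.FourManifolds.LefschetzBase.ModelsOnFibred M 0 l →
      (l.filter (·.2)).length = 2 * 0 := by
  intro M _ _ _ _ _ l e hM
  have h : l.length = 4 * 0 := stub_modelsOn_counts_length M 0 l e hM.modelsOn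
  rw [Nat.mul_zero, List.length_eq_zero_iff] at h
  subst h
  rfl

end Summit.SmoothPoincare4.SmoothPoincare4.Theorems.AcyclicBisectionExists.ModpBraidOrbits

end
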